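import Literature.NumberTheory.Transcendental.QuadraticRelationsLogarithmsThm32A
import HarnessLib

/-!
# Roy–Waldschmidt 1997, Théorème 3.2 — part B: steps 1 and 3 of (iv)

Continuation of `QuadraticRelationsLogarithmsThm32A.lean` (see there for the context): with the
sequence `Qₜ = Rₜ^{kₜ}` of Proposition 3.9 and under the negation (3.11) of (3.10) beyond `n₀`,

* `exists_max_associated` — **step 1** (p. 770): for `s ≥ δ₁` the indices `t` with `R_t`
  associated to `R_s` ("`R(Q_s, Q_t) = 0`") are bounded (`|Q_t(θ)| = |R_s(θ)|^{k_t}`,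
  `k_t ≤ t`, `log |Q_t(θ)| ≤ -κt²/64800`), so the class has a largest element `m ≥ s`;
* `step_three` — **step 3** (pp. 770–771): for such a largest `m` (`s ≥ n₀`),
  `dist(θ, Z(Q_{m+1})) < dist(θ, Z(Q_m))`; otherwise the pair lemma at `(m, m+1)`, the largest
  index `n` of the class of `m+1` (`n ≤ 54m` by comparing `log|Q_n(θ)|/deg Q_n = log|Q_{m+1}(θ)|/deg
  Q_{m+1} ≥ -3aκm`), and Corollaire 3.7 (`cor_3_7`) for the non-associated pair `(Q_m, Q_{n+1})`
  give a sign contradiction.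

Constants as re-derived in the seat's notes (`a = 1/3600`, `b = 1/18, 1/20`); no definitions, no
named facts.

## References

* [RoyWaldschmidt1997ENS] D. Roy, M. Waldschmidt, Ann. Sci. ÉNS (4) 30 (1997) 753–796, §3 (iv)
  steps 1 and 3, pp. 770–771 (lit key paper:doi-10-1016-s0012-9593-97-89938-7, PDF pp. 19–20).
-/

noncomputable section

open Polynomial Multiset

namespace Literature.NumberTheory.Transcendental

namespace RoyWaldschmidt1997

/-! ### Facts on the terms of the sequence -/

/-- For `t ≥ max(δ₁, 1)`: `R_t ≠ 0`, `R_t` is non-constant, `R_t(θ) ≠ 0`, `k_t ≤ t` and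
`k_t log|R_t(θ)| ≤ -κt²/64800`. [folklore] -/
theorem seq_facts (θ : ℂ) (hθ : Transcendental ℚ θ) (κ : ℝ) (hκ : 0 < κ) (δ₁ : ℕ) (R : ℕ → ℤ[X])
    (k : ℕ → ℕ)
    (hQ : ∀ t, δ₁ ≤ t → Irreducible (R t) ∧ 0 < k t ∧ (R t ^ k t).natDegree ≤ t ∧
      Real.log ((R t ^ k t).map (Int.castRingHom ℂ)).mahlerMeasure ≤ κ * t / 3600 ∧
      ‖aeval θ (R t ^ k t)‖ ≤ Real.exp (-(κ * t ^ 2 / 64800)))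
    (t : ℕ) (ht : δ₁ ≤ t) (ht1 : 1 ≤ t) :
    R t ≠ 0 ∧ 0 < (R t).natDegree ∧ 0 < ‖aeval θ (R t)‖ ∧ k t ≤ t ∧
      (k t : ℝ) * Real.log ‖aeval θ (R t)‖ ≤ -(κ * t ^ 2 / 64800) ∧
      Real.log ‖aeval θ (R t)‖ < 0 := by
  obtain ⟨hR, hk, hdeg, -, hsm⟩ := hQ t ht
  have ht0 : (0 : ℝ) < t := by exact_mod_cast ht1
  have hpos64 : 0 < κ * (t : ℝ) ^ 2 / 64800 := by positivity
  have hsm1 : ‖aeval θ (R t ^ k t)‖ < 1 := hsm.trans_lt (Real.exp_lt_one_iff.mpr (neg_lt_zero.mpr hpos64))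
  have hdegR : 0 < (R t).natDegree := natDegree_pos_of_pow_small hR hsm1
  have hval : 0 < ‖aeval θ (R t)‖ := norm_aeval_pos_of_transcendental hθ hR.ne_zero
  have hkt : k t ≤ t := by
    have : k t * (R t).natDegree ≤ t := by rw [← natDegree_pow]; exact hdeg
    exact le_trans (Nat.le_mul_of_pos_right _ hdegR) this
  have hlog : (k t : ℝ) * Real.log ‖aeval θ (R t)‖ ≤ -(κ * t ^ 2 / 64800) := by
    have := Real.log_le_log (by rw [map_pow, norm_pow]; exact pow_pos hval _) hsm
    rwa [Real.log_exp, map_pow, norm_pow, Real.log_pow] at this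
  refine ⟨hR.ne_zero, hdegR, hval, hkt, hlog, ?_⟩
  have hk0 : (0 : ℝ) < k t := by exact_mod_cast hk
  by_contra hpos
  push Not at hpos
  have : 0 ≤ (k t : ℝ) * Real.log ‖aeval θ (R t)‖ := mul_nonneg hk0.le hpos
  have : 0 < κ * (t : ℝ) ^ 2 / 64800 := by positivity
  linarith

/-! ### Step 1: the largest associated index -/

/-- **Step 1** (p. 770): for `s ≥ max(δ₁,1)` the class `{t ≥ max(δ₁,1) ; R_t ∼ R_s}` has a largest
element. [cite: RoyWaldschmidt1997ENS, §3 (iv) step 1, p. 770] -/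
theorem exists_max_associated (θ : ℂ) (hθ : Transcendental ℚ θ) (κ : ℝ) (hκ : 0 < κ) (δ₁ : ℕ)
    (R : ℕ → ℤ[X]) (k : ℕ → ℕ)
    (hQ : ∀ t, δ₁ ≤ t → Irreducible (R t) ∧ 0 < k t ∧ (R t ^ k t).natDegree ≤ t ∧
      Real.log ((R t ^ k t).map (Int.castRingHom ℂ)).mahlerMeasure ≤ κ * t / 3600 ∧
      ‖aeval θ (R t ^ k t)‖ ≤ Real.exp (-(κ * t ^ 2 / 64800)))
    (s : ℕ) (hs : δ₁ ≤ s) (hs1 : 1 ≤ s) :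
    ∃ m : ℕ, s ≤ m ∧ Associated (R s) (R m) ∧
      ∀ t, δ₁ ≤ t → 1 ≤ t → Associated (R s) (R t) → t ≤ m := by
  classical
  obtain ⟨-, -, hvals, -, -, hlogs⟩ := seq_facts θ hθ κ hκ δ₁ R k hQ s hs hs1
  set L := Real.log ‖aeval θ (R s)‖ with hL
  -- the bound: `R_t ∼ R_s` forces `t ≤ -64800 L / κ`
  have hbound : ∀ t, δ₁ ≤ t → 1 ≤ t → Associated (R s) (R t) → (t : ℝ) ≤ -64800 * L / κ := by
    intro t ht ht1 hass
    obtain ⟨-, -, hvalt, hkt, hlogt, hneg⟩ := seq_facts θ hθ κ hκ δ₁ R k hQ t ht ht1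
    have heq : ‖aeval θ (R t)‖ = ‖aeval θ (R s)‖ := (Polynomial.norm_aeval_eq_of_associated hass θ).symm
    rw [heq, ← hL] at hlogt
    have hkt' : (k t : ℝ) ≤ t := by exact_mod_cast hkt
    have ht0 : (0 : ℝ) < t := by exact_mod_cast ht1
    -- `t L ≤ k_t L ≤ -κ t² / 64800`
    have h1 : (t : ℝ) * L ≤ k t * L := by nlinarith
    have h2 : (t : ℝ) * L ≤ -(κ * t ^ 2 / 64800) := h1.trans hlogt
    have h3 : L ≤ -(κ * t / 64800) := by
      by_contra h; push Not at h
      have : (t : ℝ) * -(κ * t / 64800) < t * L := mul_lt_mul_of_pos_left h ht0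
      nlinarith
    rw [le_div_iff₀ hκ]; nlinarith
  set Bd : ℕ := ⌊-64800 * L / κ⌋₊ with hBd
  set I : Finset ℕ := (Finset.Icc (max δ₁ 1) Bd).filter fun t => Associated (R s) (R t) with hI
  have hmemI : ∀ t, t ∈ I ↔ (max δ₁ 1 ≤ t ∧ t ≤ Bd) ∧ Associated (R s) (R t) := fun t => by
    rw [hI, Finset.mem_filter, Finset.mem_Icc]
  have hsI : s ∈ I :=
    (hmemI s).mpr ⟨⟨max_le hs hs1, Nat.le_floor (hbound s hs hs1 (Associated.refl _))⟩, Associated.refl _⟩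
  have hIne : I.Nonempty := ⟨s, hsI⟩
  refine ⟨I.max' hIne, Finset.le_max' _ _ hsI, ((hmemI _).mp (Finset.max'_mem I hIne)).2, ?_⟩
  intro t ht ht1 hass
  exact Finset.le_max' _ _ ((hmemI t).mpr ⟨⟨max_le ht ht1, Nat.le_floor (hbound t ht ht1 hass)⟩, hass⟩)

/-! ### Numerical lemmas for step 3 -/

/-- `n ≤ 54 m` from `-κn²/64800 ≥ -κ m n / 1200`, `n > 0`. [folklore] -/
theorem step3_num1 {κ m n : ℝ} (hκ : 0 < κ) (hn : 0 < n)
    (h : -(κ * n ^ 2 / 64800) ≥ -(n * (κ * m) / 1200)) : n ≤ 54 * m := by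
  have h1 : κ * n ^ 2 / 64800 ≤ n * (κ * m) / 1200 := by linarith
  have h2 : κ * n * n ≤ κ * n * (54 * m) := by nlinarith
  have h3 : 0 < κ * n := mul_pos hκ hn
  exact le_of_mul_le_mul_left h2 h3

/-- The sign contradiction of step 3: with `d₁ ≤ m/3600`, `d₂ ≤ (n+1)/3600`, `u ≤ κm/3600`,
`v ≤ κ(n+1)/3600` (`d₂, u, v ≥ 0`), `X ≤ -κm²/64800`, `n ≤ 54m`, `m ≥ 1`, `κ ≥ 1`:
`0.7 d₁ d₂ + d₂ u + d₁ v + X < 0`. [folklore] -/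
theorem step3_num2 {κ m n d₁ d₂ u v X : ℝ} (hκ : 1 ≤ κ) (hm : 1 ≤ m) (hn0 : 0 ≤ n) (hn : n ≤ 54 * m)
    (hd₂0 : 0 ≤ d₂) (hu0 : 0 ≤ u) (hv0 : 0 ≤ v)
    (hd₁ : d₁ ≤ m / 3600) (hd₂ : d₂ ≤ (n + 1) / 3600) (hu : u ≤ κ * m / 3600)
    (hv : v ≤ κ * (n + 1) / 3600) (hX : X ≤ -(κ * m ^ 2 / 64800)) :
    0.7 * d₁ * d₂ + d₂ * u + d₁ * v + X < 0 := by
  have hn1 : n + 1 ≤ 55 * m := by linarith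
  have t1 : d₁ * d₂ ≤ m / 3600 * ((n + 1) / 3600) := mul_le_mul hd₁ hd₂ hd₂0 (by positivity)
  have t2 : d₂ * u ≤ (n + 1) / 3600 * (κ * m / 3600) := mul_le_mul hd₂ hu hu0 (by positivity)
  have t3 : d₁ * v ≤ m / 3600 * (κ * (n + 1) / 3600) := mul_le_mul hd₁ hv hv0 (by positivity)
  have hmn : m * (n + 1) ≤ 55 * m ^ 2 := by nlinarith
  have hκm : 0 ≤ κ := by linarith
  nlinarith [mul_le_mul_of_nonneg_left hmn hκm, mul_nonneg hκm (sq_nonneg m)]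

/-- The ratio argument of step 3 over the reals: `n ≤ 54 m`. [folklore] -/
theorem step3_ratio {κ m n L u e km1 kn : ℝ} (hκ : 0 < κ) (hn : 0 < n) (hkm1 : 0 < km1)
    (hkn0 : 0 ≤ kn) (he0 : 0 ≤ e) (hm0 : 0 ≤ m) (hu : u ≤ κ * m / 3600)
    (h14 : -3 * (km1 * e) * u ≤ km1 * L) (hkne : kn * e ≤ n)
    (hup : kn * L ≤ -(κ * n ^ 2 / 64800)) : n ≤ 54 * m := by
  have hκm : 0 ≤ κ * m := mul_nonneg hκ.le hm0
  have h1 : km1 * (-3 * e * (κ * m / 3600)) ≤ km1 * L := by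
    nlinarith [mul_le_mul_of_nonneg_left hu (mul_nonneg hkm1.le he0)]
  have hL : -3 * e * (κ * m / 3600) ≤ L := le_of_mul_le_mul_left h1 hkm1
  have h2 : -(n * (κ * m) / 1200) ≤ kn * L := by
    nlinarith [mul_le_mul_of_nonneg_left hL hkn0, mul_le_mul_of_nonneg_right hkne hκm]
  exact step3_num1 hκ hn (ge_iff_le.mpr (h2.trans hup))

/-- The contradiction closing step 3: Corollaire 3.7 for the coprime pair `(Q_m, Q_{n+1})` with the
degree, Mahler-measure and smallness bounds of (3.14)–(3.15) is impossible.
[cite: RoyWaldschmidt1997ENS, §3 (iv) step 3, p. 771] -/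
theorem step3_contra (θ : ℂ) (F G : ℤ[X]) (hF : F ≠ 0) (hG : G ≠ 0)
    (hcop : IsCoprime (F.map (Int.castRingHom ℚ)) (G.map (Int.castRingHom ℚ))) {κ m n : ℝ}
    (hκ1 : 1 ≤ κ) (hm : 1 ≤ m) (hn0 : 0 ≤ n) (hn : n ≤ 54 * m)
    (hdF : (F.natDegree : ℝ) ≤ m / 3600) (hdG : (G.natDegree : ℝ) ≤ (n + 1) / 3600)
    (hMF : Real.log (F.map (Int.castRingHom ℂ)).mahlerMeasure ≤ κ * m / 3600)
    (hMG : Real.log (G.map (Int.castRingHom ℂ)).mahlerMeasure ≤ κ * (n + 1) / 3600)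
    (hFpos : 0 < ‖aeval θ F‖)
    (hsmall : max ‖aeval θ F‖ ‖aeval θ G‖ ≤ Real.exp (-(κ * m ^ 2 / 64800))) : False := by
  have h37 := cor_3_7 F G hF hG hcop θ
  have hMF1 : 1 ≤ (F.map (Int.castRingHom ℂ)).mahlerMeasure := one_le_mahlerMeasure_of_ne_zero hF
  have hMG1 : 1 ≤ (G.map (Int.castRingHom ℂ)).mahlerMeasure := one_le_mahlerMeasure_of_ne_zero hG
  have hMF0 : 0 < (F.map (Int.castRingHom ℂ)).mahlerMeasure := one_pos.trans_le hMF1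
  have hMG0 : 0 < (G.map (Int.castRingHom ℂ)).mahlerMeasure := one_pos.trans_le hMG1
  have hmaxpos : 0 < max ‖aeval θ F‖ ‖aeval θ G‖ := lt_max_of_lt_left hFpos
  have hlog := Real.log_le_log one_pos h37
  rw [Real.log_one, Real.log_mul (by positivity) hmaxpos.ne', Real.log_mul (by positivity) (by positivity),
    Real.log_mul (by positivity) (by positivity), Real.log_pow, Real.log_pow, Real.log_pow, Nat.cast_mul] at hlog
  have hmaxle : Real.log (max ‖aeval θ F‖ ‖aeval θ G‖) ≤ -(κ * m ^ 2 / 64800) := by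
    have := Real.log_le_log hmaxpos hsmall; rwa [Real.log_exp] at this
  have hu0 : 0 ≤ Real.log (F.map (Int.castRingHom ℂ)).mahlerMeasure := Real.log_nonneg hMF1
  have hv0 : 0 ≤ Real.log (G.map (Int.castRingHom ℂ)).mahlerMeasure := Real.log_nonneg hMG1
  have hd₁0 : (0 : ℝ) ≤ F.natDegree := Nat.cast_nonneg _
  have hd₂0 : (0 : ℝ) ≤ G.natDegree := Nat.cast_nonneg _
  have hlog2 : Real.log 2 < 0.7 := by have := Real.log_two_lt_d9; linarith
  have hlog20 : 0 ≤ Real.log 2 := Real.log_nonneg (by norm_num)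
  have hfin := step3_num2 hκ1 hm hn0 hn hd₂0 hu0 hv0 hdF hdG hMF hMG hmaxle
  nlinarith [mul_le_mul_of_nonneg_left hlog2.le (mul_nonneg hd₁0 hd₂0)]

/-! ### Step 3 -/

set_option maxHeartbeats 400000 in
/-- **Step 3** (pp. 770–771).  Under the hypotheses of `pair_step` on the sequence, `κ ≥ 3600`, the
negation (3.11) of (3.10) beyond `n₀ ≥ max(δ₁, 20)`, for `s ≥ n₀` and `m` the largest index with
`R_m ∼ R_s`: `|θ - α_{m+1}| < |θ - α_m|`.
[cite: RoyWaldschmidt1997ENS, §3 (iv) step 3, pp. 770–771] -/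
theorem step_three (θ : ℂ) (hθ : Transcendental ℚ θ) (κ : ℝ) (hκ : 3600 ≤ κ) (δ₁ : ℕ)
    (R : ℕ → ℤ[X]) (k : ℕ → ℕ) (α : ℕ → ℂ)
    (hQ : ∀ t, δ₁ ≤ t → Irreducible (R t) ∧ 0 < k t ∧ (R t ^ k t).natDegree ≤ t ∧
      Real.log ((R t ^ k t).map (Int.castRingHom ℂ)).mahlerMeasure ≤ κ * t / 3600 ∧
      ‖aeval θ (R t ^ k t)‖ ≤ Real.exp (-(κ * t ^ 2 / 64800)))
    (hα : ∀ t, δ₁ ≤ t → α t ∈ ((R t).map (Int.castRingHom ℂ)).roots ∧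
      ∀ β ∈ ((R t).map (Int.castRingHom ℂ)).roots, ‖θ - α t‖ ≤ ‖θ - β‖)
    (n₀ : ℕ) (hn₀δ : δ₁ ≤ n₀) (hn₀20 : 20 ≤ n₀)
    (h11 : ∀ t, n₀ ≤ t →
      ¬ ((t : ℝ) / 3600 ≤ (R t ^ k t).natDegree ∧ ‖θ - α t‖ ≤ Real.exp (-(κ * t ^ 2 / 10 ^ 7))))
    (s : ℕ) (hs : n₀ ≤ s) (m : ℕ) (hsm : s ≤ m) (hass : Associated (R s) (R m))
    (hmax : ∀ t, δ₁ ≤ t → 1 ≤ t → Associated (R s) (R t) → t ≤ m) :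
    ‖θ - α (m + 1)‖ < ‖θ - α m‖ := by
  have hκpos : 0 < κ := by linarith
  have hκ1 : 1 ≤ κ := by linarith
  have hδm : δ₁ ≤ m := hn₀δ.trans (hs.trans hsm)
  have hδm1 : δ₁ ≤ m + 1 := hδm.trans (Nat.le_succ m)
  have hm20 : 20 ≤ m := hn₀20.trans (hs.trans hsm)
  have hm1 : 1 ≤ m := le_trans (by norm_num) hm20
  -- generic facts
  have hfm := seq_facts θ hθ κ hκpos δ₁ R k hQ m hδm hm1
  have hfm1 := seq_facts θ hθ κ hκpos δ₁ R k hQ (m + 1) hδm1 (Nat.succ_pos m)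
  obtain ⟨hRm, hkm, hdegQm, hMm, hsmm⟩ := hQ m hδm
  obtain ⟨hRm1, hkm1, hdegQm1, hMm1, hsmm1⟩ := hQ (m + 1) hδm1
  -- `R_m`, `R_{m+1}` not associated
  have hna : ¬ Associated (R m) (R (m + 1)) := fun h =>
    absurd (hmax (m + 1) hδm1 (Nat.succ_pos m) (hass.trans h)) (by omega)
  by_contra hD
  push Not at hD
  -- the pair lemma at `(m, m+1)`
  have hcop := isCoprime_pow_of_not_associated hRm hRm1 hfm.2.1 hfm1.2.1 hna (k m) (k (m + 1))
  obtain ⟨hd14, -, hlog14, hD14, -⟩ := pair_step θ κ hκ δ₁ R k α hQ hα m (m + 1) m hδm hδm1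
    (le_trans (by norm_num) hm20) le_rfl (Nat.le_succ m) (Nat.le_succ m) le_rfl hD hcop
    (h11 m (hs.trans hsm)) (h11 (m + 1) ((hs.trans hsm).trans (Nat.le_succ m)))
  -- the class of `m + 1` and its largest element `n`
  obtain ⟨n, hmn, hassn, hmaxn⟩ := exists_max_associated θ hθ κ hκpos δ₁ R k hQ (m + 1) hδm1 (Nat.succ_pos m)
  have hδn : δ₁ ≤ n := hδm1.trans hmn
  have hδn1 : δ₁ ≤ n + 1 := hδn.trans (Nat.le_succ n)
  have hn20 : 20 ≤ n := by omega
  have hn1 : 1 ≤ n := by omega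
  have hfn := seq_facts θ hθ κ hκpos δ₁ R k hQ n hδn hn1
  have hfn1 := seq_facts θ hθ κ hκpos δ₁ R k hQ (n + 1) hδn1 (Nat.succ_pos n)
  obtain ⟨hRn, hkn, hdegQn, hMn, hsmn⟩ := hQ n hδn
  obtain ⟨hRn1, hkn1, hdegQn1, hMn1, hsmn1⟩ := hQ (n + 1) hδn1
  -- same roots, degree and value for `R_{m+1} ∼ R_n`
  have hrootsn : ((R n).map (Int.castRingHom ℂ)).roots = ((R (m + 1)).map (Int.castRingHom ℂ)).roots :=
    roots_eq_of_associated hassn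
  have hDn : ‖θ - α n‖ = ‖θ - α (m + 1)‖ := by
    refine le_antisymm ?_ ?_
    · exact (hα n hδn).2 _ (hrootsn ▸ (hα (m + 1) hδm1).1)
    · exact (hα (m + 1) hδm1).2 _ (hrootsn.symm ▸ (hα n hδn).1)
  have hdegRn : (R n).natDegree = (R (m + 1)).natDegree := natDegree_eq_of_associated hassn
  have hvaln : ‖aeval θ (R n)‖ = ‖aeval θ (R (m + 1))‖ := (Polynomial.norm_aeval_eq_of_associated hassn θ).symm
  -- `R_n`, `R_{n+1}` not associated
  have hnan : ¬ Associated (R n) (R (n + 1)) := fun h =>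
    absurd (hmaxn (n + 1) hδn1 (Nat.succ_pos n) (hassn.trans h)) (by omega)
  -- the pair `(n, n+1)` is ordered with `F = Q_{n+1}`
  have hDn1 : ‖θ - α (n + 1)‖ < ‖θ - α n‖ := by
    by_contra h'
    push Not at h'
    have hcop' := isCoprime_pow_of_not_associated hRn hRn1 hfn.2.1 hfn1.2.1 hnan (k n) (k (n + 1))
    obtain ⟨-, -, -, -, h5⟩ := pair_step θ κ hκ δ₁ R k α hQ hα n (n + 1) n hδn hδn1
      (le_trans (by norm_num) hn20) le_rfl (Nat.le_succ n) (Nat.le_succ n) le_rfl h' hcop'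
      (h11 n (by omega)) (h11 (n + 1) (by omega))
    -- `D_n ≤ exp(-κ(n+1)²/4320000) ≤ exp(-κ(m+1)²/10⁷) < D_{m+1} = D_n`
    have h6 : Real.exp (-(κ * ((n : ℝ) + 1) ^ 2 / 4320000)) ≤ Real.exp (-(κ * ((m : ℝ) + 1) ^ 2 / 10 ^ 7)) := by
      refine Real.exp_le_exp.mpr ?_
      have hmn' : ((m : ℝ) + 1) ^ 2 ≤ ((n : ℝ) + 1) ^ 2 := by
        have h0 : ((m + 1 : ℕ) : ℝ) ≤ n := by exact_mod_cast hmn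
        push_cast at h0
        nlinarith [show (0:ℝ) ≤ (m:ℝ) + 1 by positivity]
      have h7 : κ * ((m : ℝ) + 1) ^ 2 / 10 ^ 7 ≤ κ * ((m : ℝ) + 1) ^ 2 / 4320000 :=
        div_le_div_of_nonneg_left (by positivity) (by norm_num) (by norm_num)
      have h8 : κ * ((m : ℝ) + 1) ^ 2 / 4320000 ≤ κ * ((n : ℝ) + 1) ^ 2 / 4320000 :=
        div_le_div_of_nonneg_right (mul_le_mul_of_nonneg_left hmn' hκpos.le) (by norm_num)
      linarith
    have : ‖θ - α n‖ < ‖θ - α n‖ := by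
      calc ‖θ - α n‖ ≤ _ := h5
        _ ≤ _ := h6
        _ < ‖θ - α (m + 1)‖ := by exact_mod_cast hD14
        _ = ‖θ - α n‖ := hDn.symm
    exact lt_irrefl _ this
  have hcop'' := isCoprime_pow_of_not_associated hRn1 hRn hfn1.2.1 hfn.2.1 (fun h => hnan h.symm)
    (k (n + 1)) (k n)
  obtain ⟨hd15, -, -, -, -⟩ := pair_step θ κ hκ δ₁ R k α hQ hα (n + 1) n n hδn1 hδn
    (le_trans (by norm_num) hn20) (Nat.le_succ n) le_rfl le_rfl (Nat.le_succ n) hDn1.le hcop''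
    (h11 (n + 1) (by omega)) (h11 n (by omega))
  -- the ratio argument: `n ≤ 54 m`
  have hkm1pos : (0 : ℝ) < k (m + 1) := by exact_mod_cast hkm1
  have h14' : -3 * ((k (m + 1) : ℝ) * (R (m + 1)).natDegree) *
      Real.log ((R m ^ k m).map (Int.castRingHom ℂ)).mahlerMeasure ≤
      k (m + 1) * Real.log ‖aeval θ (R (m + 1))‖ := by
    have h1 : Real.log ‖aeval θ (R (m + 1) ^ k (m + 1))‖ = k (m + 1) * Real.log ‖aeval θ (R (m + 1))‖ := by
      rw [map_pow, norm_pow, Real.log_pow]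
    have h2 : ((R (m + 1) ^ k (m + 1)).natDegree : ℝ) = k (m + 1) * (R (m + 1)).natDegree := by
      rw [natDegree_pow]; push_cast; ring
    rw [h1, h2] at hlog14
    exact hlog14
  have hkne : (k n : ℝ) * (R (m + 1)).natDegree ≤ n := by
    have : k n * (R n).natDegree ≤ n := by rw [← natDegree_pow]; exact hdegQn
    rw [hdegRn] at this; exact_mod_cast this
  have hup : (k n : ℝ) * Real.log ‖aeval θ (R (m + 1))‖ ≤ -(κ * n ^ 2 / 64800) := by
    have := Real.log_le_log (by rw [map_pow, norm_pow]; exact pow_pos hfn.2.2.1 _) hsmn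
    rwa [Real.log_exp, map_pow, norm_pow, Real.log_pow, hvaln] at this
  have hn54 : (n : ℝ) ≤ 54 * m :=
    step3_ratio hκpos (by exact_mod_cast hn1) hkm1pos (Nat.cast_nonneg _) (Nat.cast_nonneg _)
      (Nat.cast_nonneg _) hMm h14' hkne hup
  -- `Q_m`, `Q_{n+1}` not associated, hence coprime; Corollaire 3.7 gives the contradiction
  have hna2 : ¬ Associated (R m) (R (n + 1)) := fun h =>
    absurd (hmax (n + 1) hδn1 (Nat.succ_pos n) (hass.trans h)) (by omega)
  have hcop2 := isCoprime_pow_of_not_associated hRm hRn1 hfm.2.1 hfn1.2.1 hna2 (k m) (k (n + 1))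
  have hsmall2 : max ‖aeval θ (R m ^ k m)‖ ‖aeval θ (R (n + 1) ^ k (n + 1))‖ ≤
      Real.exp (-(κ * m ^ 2 / 64800)) := by
    refine max_le hsmm (hsmn1.trans (Real.exp_le_exp.mpr ?_))
    push_cast
    have h0 : ((m + 1 : ℕ) : ℝ) ≤ n := by exact_mod_cast hmn
    push_cast at h0
    have h1 : (m : ℝ) ^ 2 ≤ ((n : ℝ) + 1) ^ 2 := by nlinarith [show (0:ℝ) ≤ m from Nat.cast_nonneg _]
    have := div_le_div_of_nonneg_right (mul_le_mul_of_nonneg_left h1 hκpos.le) (by norm_num : (0:ℝ) ≤ 64800)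
    linarith
  exact step3_contra θ (R m ^ k m) (R (n + 1) ^ k (n + 1)) (pow_ne_zero _ hRm.ne_zero)
    (pow_ne_zero _ hRn1.ne_zero) hcop2 hκ1 (by exact_mod_cast hm1) (Nat.cast_nonneg n) hn54 hd14.le
    (by push_cast at hd15 ⊢; exact hd15.le) hMm (by push_cast at hMn1 ⊢; exact hMn1)
    (by rw [map_pow, norm_pow]; exact pow_pos hfm.2.2.1 _) hsmall2

end RoyWaldschmidt1997

end Literature.NumberTheory.Transcendental
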